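import Literature.Dynamics.Hamiltonian.ArnoldDiffusionCAP.InstanceB

/-!
# Sanity lemmas for `InstanceB.IsSolution` (the Froeschlé–Guzzo–Lega vector field, FGL 2005 eq. (1)) — pub-adcap REVIEW-RUNBOOK

Review evidence only (ops-runbook sanity registry `registry/pub-adcap.json`); no new definitions.  Placed next to
`InstanceB.lean` (there is no `Summits/ArnoldDiffusion` problem nor a registered venture topic for this cell); like
`InstanceB.denom_ge`, every statement here is an elementary property OF the cited equation (1) — its explicit solution on
the axis `φ₁ = φ₂ = I₁ = I₂ = 0` — and carries that equation's citation tag; nothing here is a claim of the paper.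
`IsSolution c ε γ` (`Literature/Dynamics/Hamiltonian/ArnoldDiffusionCAP/InstanceB.lean`) says `γ : ℝ → ℝ⁶` has derivative
`vectorField c ε (γ t)` at every time: `φ₁' = I₁, φ₂' = I₂, φ₃' = 1, Iᵢ' = −ε sin φᵢ / D(φ)²`.

* HOLDS (explicit solution for EVERY `c, ε`): on the invariant axis `φ₁ = φ₂ = 0`, `I₁ = I₂ = 0` the system reduces to
  `φ₃' = 1`, `I₃' = −ε sin φ₃ / (5 + c + cos φ₃)²`, solved by `φ₃ = t`, `I₃ = −ε / (5 + c + cos t)` whenever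
  `5 + c + cos t ≠ 0` (e.g. `c > -4`): `axisSolution c ε` written as a lambda, no definition.  Its `(I₁, I₂)`-displacement
  `actionDist` is identically `0` — drift in the sense of `Claim` is about `(I₁, I₂)`, and this solution has none.
* FAILS: a constant path is never a solution (`φ₃' = 1 ≠ 0`).
-/

namespace Literature.Dynamics.Hamiltonian.ArnoldDiffusionCAP.InstanceB

/-- The value of the explicit axis solution at time `t`: `(0, 0, t, 0, 0, −ε/(5 + c + cos t))`: the right-hand side of eq. (1) there. (A term, not a definition.)
[cite: FroeschleGuzzoLega2005, eq. (1)] -/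
theorem vectorField_axis (c ε t : ℝ) :
    vectorField c ε ![0, 0, t, 0, 0, -ε / (5 + c + Real.cos t)] =
      ![0, 0, 1, 0, 0, -ε * Real.sin t / (5 + c + Real.cos t) ^ 2] := by
  ext i
  fin_cases i <;> simp [vectorField, denom]
  ring

/-- HOLDS: for every `c` with `-4 < c` and every `ε`, the path `t ↦ (0, 0, t, 0, 0, −ε/(5 + c + cos t))` is a global
solution of the Instance-B system: on the axis `φ₁ = φ₂ = I₁ = I₂ = 0` the perturbing forces on `I₁, I₂` vanish
(`sin 0 = 0`), `φ₃` advances at unit speed and `I₃' = −ε sin t/(5 + c + cos t)² = d/dt(−ε/(5 + c + cos t))` — an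
explicit solution of eq. (1). [cite: FroeschleGuzzoLega2005, eq. (1)] -/
theorem isSolution_axis (c ε : ℝ) (hc : -4 < c) :
    IsSolution c ε (fun t ↦ ![0, 0, t, 0, 0, -ε / (5 + c + Real.cos t)]) := by
  intro t
  have hD : 5 + c + Real.cos t ≠ 0 := by
    have := Real.neg_one_le_cos t
    intro h
    linarith
  rw [vectorField_axis, hasDerivAt_pi]
  intro i
  fin_cases i
  · simpa using hasDerivAt_const t (0 : ℝ)
  · simpa using hasDerivAt_const t (0 : ℝ)
  · simpa using hasDerivAt_id' t
  · simpa using hasDerivAt_const t (0 : ℝ)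
  · simpa using hasDerivAt_const t (0 : ℝ)
  · -- d/dt (−ε / (5 + c + cos t)) = −ε sin t / (5 + c + cos t)²  (quotient rule with a constant numerator)
    have h1 : HasDerivAt (fun s ↦ 5 + c + Real.cos s) (-Real.sin t) t := by
      simpa using (Real.hasDerivAt_cos t).const_add (5 + c)
    have h2 := ((hasDerivAt_const t (-ε)).div h1 hD).congr_deriv
      (show (0 * (5 + c + Real.cos t) - -ε * -Real.sin t) / (5 + c + Real.cos t) ^ 2 =
          -ε * Real.sin t / (5 + c + Real.cos t) ^ 2 by ring)
    have h3 : HasDerivAt (fun s ↦ -ε / (5 + c + Real.cos s)) (-ε * Real.sin t / (5 + c + Real.cos t) ^ 2) t := h2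
    simpa using h3

/-- Along the axis solution the `(I₁, I₂)`-displacement is identically zero: no drift in the sense of `Claim`
(which measures `actionDist`, the displacement in the `(I₁, I₂)`-plane), although `I₃` oscillates with amplitude `O(ε)`.
[cite: FroeschleGuzzoLega2005, eq. (1)] -/
theorem actionDist_axis (c ε s t : ℝ) :
    actionDist ![0, 0, t, 0, 0, -ε / (5 + c + Real.cos t)] ![0, 0, s, 0, 0, -ε / (5 + c + Real.cos s)] = 0 := by
  simp [actionDist]

/-- FAILS: a constant path is not a solution of eq. (1), for any parameters (`φ₃' = 1`, but a constant has derivative `0`).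
[cite: FroeschleGuzzoLega2005, eq. (1)] -/
theorem not_isSolution_const (c ε : ℝ) (x : Pt) : ¬ IsSolution c ε (fun _ ↦ x) := by
  intro h
  have h0 := (hasDerivAt_pi.1 (h 0)) 2
  have hc' : HasDerivAt (fun _ : ℝ ↦ x 2) 0 0 := hasDerivAt_const 0 (x 2)
  have := h0.unique hc'
  simp [vectorField] at this

end Literature.Dynamics.Hamiltonian.ArnoldDiffusionCAP.InstanceB
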